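import Mathlib.Data.Fintype.Powerset
import Mathlib.Data.Finset.Powerset
import Literature.Computability.AlgebraicComplexity.DeterminantalComplexity
import Literature.Computability.AlgebraicComplexity.PermanentVsDeterminantProofs

/-!
# `DetqpThesis` (stmt-ValiantsHypothesis-0315), line `fat-row-recursion` — stub S5 (calibration):
# Grenet's representation is row-partitioned with the binomial profile

A ROW-PARTITIONED affine determinantal representation of `per_n = perPoly (Fin n) ℂ` of size `M`
is an affine determinantal representation `A` (`IsAffineDetRepr`) together with a map
`β : Fin M → Fin n` such that matrix row `a` reads only the variables `X (•, β a)`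
(`coeff (single e 1) (A a b) ≠ 0 → e.2 = β a`); block `c` is `{a | β a = c}`.

This file proves that Grenet's `(2ⁿ - 1) × (2ⁿ - 1)` representation (tree:
`Literature.Computability.AlgebraicComplexity.determinantalComplexity_perPoly_le_holds`) is of this
kind, with block `c` of size `n.choose c` (`stub_grenetRowPartitioned`).  The matrix is the one of
the tree proof, verbatim: with `A` the weighted adjacency matrix of the subset lattice of `Fin n`
(arc `S → insert j S` of weight `X (j, |S|)`) and `e : Finset (Fin n) ≃ Fin 2ⁿ`, the minor of
`1 - A` deleting the row of `univ` and the column of `∅`, times the sign `(-1) ^ (e univ + e ∅)`.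
Row `p` of the minor is the row of the subset `S p := e.symm ((e univ).succAbove p) ≠ univ`, whose
entries are `±[S p = T]` minus `± ∑_{j ∉ S p, T = insert j (S p)} X (j, |S p|)`: they read only the
variables of `x`-column `|S p| < n`, so `β p := |S p|`, and block `c` is in bijection with the
`c`-subsets of `Fin n` (`p ↦ S p`; `c < n` excludes `univ`), of size `n.choose c`.

* `exists_rowPartitioned` — the construction for `2 ^ n = N + 1` (adapted from
  `Literature/Computability/AlgebraicComplexity/PermanentVsDeterminantProofs.lean`, proof of
  `determinantalComplexity_perPoly_le_holds`, extended by the support and profile clauses).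
* `stub_grenetRowPartitioned` — the registered signature (`N := 2 ^ n - 1`).

Sources: B. Grenet, *An upper bound for the permanent versus determinant problem* (2011), Thm. 1
(key `Grenet2011`); J. M. Landsberg, N. Ressayre, *Permanent v. determinant: an exponential lower
bound assuming symmetry*, ITCS 2016, §2.2.  Not here: the other stubs of the line (normal form,
deletion, telescope, fat block) and the consequences of S5 drawn in the line's skeleton.
-/

-- single-conjunct layout: Sub = Summit, duplicated namespace component intended
set_option linter.dupNamespace false

noncomputable section

namespace Summit.ValiantsHypothesis.ValiantsHypothesis.Theorems.DetQPDetqpThesis.FatRowGrenet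

open MvPolynomial Matrix Finset
open Literature.Computability.AlgebraicComplexity

/-- **Grenet's representation is row-partitioned with the binomial profile** (size `N` with
`2 ^ n = N + 1`, `n ≥ 1`): there are an `N × N` matrix `G` of affine entries over
`MvPolynomial (Fin n × Fin n) ℂ` with `det G = per_n` and `β : Fin N → Fin n` such that row `p` of
`G` involves only the variables `X (j, β p)`, and `|{p | β p = c}| = n.choose c` for every
`c : Fin n`.  The matrix is Grenet's (the signed minor of `1 - A`, `A` the weighted adjacency matrix
of the subset lattice, as in `determinantalComplexity_perPoly_le_holds`), `β p = |S p|` for the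
subset `S p ≠ univ` indexing row `p`. [cite: Grenet2011, Thm. 1] -/
theorem exists_rowPartitioned {n N : ℕ} (hn : 1 ≤ n) (hN : 2 ^ n = N + 1) :
    ∃ (G : Matrix (Fin N) (Fin N) (MvPolynomial (Fin n × Fin n) ℂ)) (β : Fin N → Fin n),
      IsAffineDetRepr (perPoly (Fin n) ℂ) G ∧
      (∀ a b (e : Fin n × Fin n), coeff (Finsupp.single e 1) (G a b) ≠ 0 → e.2 = β a) ∧
      ∀ c : Fin n, (Finset.univ.filter fun a => β a = c).card = n.choose c := by
  -- adapted from Literature/Computability/AlgebraicComplexity/PermanentVsDeterminantProofs.lean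
  -- (`determinantalComplexity_perPoly_le_holds`), with the support and profile bookkeeping added
  -- the weights `w j c = X (j, c)` (junk `0` for `c ≥ n`, never used) and the adjacency matrix
  obtain ⟨w, hwX, hwdeg, hwsupp⟩ : ∃ w : Fin n → ℕ → MvPolynomial (Fin n × Fin n) ℂ,
      (∀ (j : Fin n) (c : Fin n), w j c = X (j, c)) ∧ (∀ j c, (w j c).totalDegree ≤ 1) ∧
      ∀ j c (x : Fin n × Fin n), coeff (Finsupp.single x 1) (w j c) ≠ 0 → (x.2 : ℕ) = c := by
    refine ⟨fun j c => if h : c < n then X (j, ⟨c, h⟩) else 0, fun j c => by simp, fun j c => ?_,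
      fun j c x hx => ?_⟩
    · dsimp only
      split_ifs
      · exact (totalDegree_X _).le
      · simp
    · dsimp only at hx
      by_cases h : c < n
      · rw [dif_pos h, coeff_X, Ne, ite_eq_right_iff, Classical.not_imp,
          Finsupp.single_left_inj one_ne_zero] at hx
        rw [← hx.1]
      · rw [dif_neg h] at hx
        exact absurd (coeff_zero _) hx
  obtain ⟨A, hA⟩ : ∃ A : Matrix (Finset (Fin n)) (Finset (Fin n)) (MvPolynomial (Fin n × Fin n) ℂ),
      ∀ S T, A S T = ∑ j, if j ∉ S ∧ T = insert j S then w j S.card else 0 :=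
    ⟨Matrix.of fun S T => ∑ j, if j ∉ S ∧ T = insert j S then w j S.card else 0, fun _ _ => rfl⟩
  have hcard : Fintype.card (Finset (Fin n)) = N + 1 := by
    rw [Fintype.card_finset, Fintype.card_fin, hN]
  obtain ⟨e⟩ : Nonempty (Finset (Fin n) ≃ Fin (N + 1)) := ⟨Fintype.equivFinOfCardEq hcard⟩
  -- the entries of `1 - A` are affine
  have hdeg : ∀ S T, ((1 - A) S T).totalDegree ≤ 1 := by
    intro S T
    rw [Matrix.sub_apply]
    refine (totalDegree_sub _ _).trans (max_le ?_ ?_)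
    · rw [Matrix.one_apply]
      split_ifs <;> simp
    · rw [hA]
      refine totalDegree_finsetSum_le fun j _ => ?_
      split_ifs
      · exact hwdeg _ _
      · simp
  -- row `S` of `1 - A` reads only the variables `X (j, |S|)`
  have hsupp : ∀ S T (x : Fin n × Fin n),
      coeff (Finsupp.single x 1) ((1 - A) S T) ≠ 0 → (x.2 : ℕ) = S.card := by
    intro S T x hx
    rw [Matrix.sub_apply, coeff_sub, Matrix.one_apply] at hx
    have h1 : coeff (Finsupp.single x 1)
        (if S = T then (1 : MvPolynomial (Fin n × Fin n) ℂ) else 0) = 0 := by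
      split_ifs
      · rw [coeff_one, if_neg (Finsupp.single_ne_zero.mpr one_ne_zero).symm]
      · exact coeff_zero _
    rw [h1, zero_sub, neg_ne_zero, hA, coeff_sum] at hx
    obtain ⟨j, -, hj⟩ := Finset.exists_ne_zero_of_sum_ne_zero hx
    split_ifs at hj
    · exact hwsupp j S.card x hj
    · exact absurd (coeff_zero _) hj
  -- the `(∅, univ)` cofactor of `1 - A` is the permanent
  have hadj : ((1 - A).submatrix e.symm e.symm).adjugate (e ∅) (e univ) = perPoly (Fin n) ℂ := by
    rw [Matrix.adjugate_submatrix_equiv_self, Matrix.submatrix_apply, e.symm_apply_apply,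
      e.symm_apply_apply, Grenet.adjugate_one_sub_empty_univ w hA, Grenet.sum_ite_injective,
      perPoly, Matrix.permanent]
    refine sum_congr rfl fun σ _ => prod_congr rfl fun t _ => ?_
    rw [hwX, Matrix.mvPolynomialX_apply]
  rw [Matrix.adjugate_fin_succ_eq_det_submatrix] at hadj
  have hodd : Odd N := by
    have h2 : Even (N + 1) := hN ▸ Nat.even_pow.mpr ⟨even_two, by omega⟩
    exact Nat.not_even_iff_odd.mp (Nat.even_add_one.mp h2)
  -- row `p` of the minor is the row of the subset `e.symm ((e univ).succAbove p) ≠ univ`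
  have hne : ∀ p : Fin N, e.symm ((e univ).succAbove p) ≠ univ := fun p h =>
    Fin.succAbove_ne (e univ) p (e.symm_apply_eq.mp h)
  have hlt : ∀ p : Fin N, (e.symm ((e univ).succAbove p)).card < n := fun p => by
    have h := (Finset.card_lt_iff_ne_univ _).mpr (hne p)
    rwa [Fintype.card_fin] at h
  refine ⟨(-1 : MvPolynomial (Fin n × Fin n) ℂ) ^ ((e univ : ℕ) + (e ∅ : ℕ)) •
    ((1 - A).submatrix e.symm e.symm).submatrix (e univ).succAbove (e ∅).succAbove,
    fun p => ⟨(e.symm ((e univ).succAbove p)).card, hlt p⟩, ⟨?_, ?_⟩, ?_, ?_⟩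
  · intro p q
    rw [Matrix.smul_apply, smul_eq_mul]
    refine (totalDegree_mul _ _).trans ?_
    have h1 : ((-1 : MvPolynomial (Fin n × Fin n) ℂ) ^ ((e univ : ℕ) + (e ∅ : ℕ))).totalDegree
        = 0 := by
      refine Nat.eq_zero_of_le_zero ((totalDegree_pow _ _).trans ?_)
      rw [totalDegree_neg, totalDegree_one, mul_zero]
    rw [h1, zero_add]
    exact hdeg _ _
  · rw [Matrix.det_smul, Fintype.card_fin, ← pow_mul, pow_mul', hodd.neg_one_pow]
    exact hadj
  · intro p q x hx
    refine Fin.ext (hsupp (e.symm ((e univ).succAbove p)) (e.symm ((e ∅).succAbove q)) x ?_)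
    rw [Matrix.smul_apply, smul_eq_mul, Matrix.submatrix_apply, Matrix.submatrix_apply] at hx
    rcases neg_one_pow_eq_or (MvPolynomial (Fin n × Fin n) ℂ) ((e univ : ℕ) + (e ∅ : ℕ)) with
      h | h
    · rwa [h, one_mul] at hx
    · rwa [h, neg_one_mul, coeff_neg, neg_ne_zero] at hx
  · intro c
    have hpc : (powersetCard (c : ℕ) (univ : Finset (Fin n))).card = n.choose c := by
      rw [Finset.card_powersetCard, Finset.card_univ, Fintype.card_fin]
    rw [← hpc]
    refine Finset.card_bij (fun p _ => e.symm ((e univ).succAbove p)) (fun p hp => ?_)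
      (fun p₁ _ p₂ _ h => Fin.succAbove_right_injective (e.symm.injective h)) (fun T hT => ?_)
    · rw [Finset.mem_filter] at hp
      rw [Finset.mem_powersetCard]
      exact ⟨Finset.subset_univ _, congrArg Fin.val hp.2⟩
    · rw [Finset.mem_powersetCard] at hT
      have hTne : e T ≠ e univ := by
        intro h
        rw [e.injective h, Finset.card_univ, Fintype.card_fin] at hT
        exact absurd hT.2 (by have := c.isLt; omega)
      obtain ⟨p, hp⟩ := Fin.exists_succAbove_eq hTne
      refine ⟨p, ?_, ?_⟩
      · rw [Finset.mem_filter]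
        refine ⟨Finset.mem_univ _, Fin.ext ?_⟩
        show (e.symm ((e univ).succAbove p)).card = (c : ℕ)
        rw [hp, e.symm_apply_apply]
        exact hT.2
      · show e.symm ((e univ).succAbove p) = T
        rw [hp, e.symm_apply_apply]

/-- **S5 — calibration: Grenet's representation is row-partitioned with the binomial profile.**
For `n ≥ 1`, Grenet's `(2ⁿ - 1) × (2ⁿ - 1)` affine matrix for `per_n` (tree:
`determinantalComplexity_perPoly_le_holds`; the minor of `1 - A` for the weighted adjacency matrix
`A` of the subset lattice, arc `S → insert j S` of weight `X (j, |S|)`, row `univ` and column `∅`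
deleted, times a sign) is an affine determinantal representation of `perPoly (Fin n) ℂ` whose row
`S` (`S ≠ univ`) reads only the variables `X (j, |S|)`: it is row-partitioned with `β S = |S|`,
and block `c < n` consists of the subsets of cardinality `c`, of size `n.choose c`.
[cite: Grenet2011, Thm. 1] -/
theorem stub_grenetRowPartitioned :
    ∀ n : ℕ, 1 ≤ n →
      ∃ (A : Matrix (Fin (2 ^ n - 1)) (Fin (2 ^ n - 1)) (MvPolynomial (Fin n × Fin n) ℂ))
        (β : Fin (2 ^ n - 1) → Fin n),
        IsAffineDetRepr (perPoly (Fin n) ℂ) A ∧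
        (∀ a b (e : Fin n × Fin n), coeff (Finsupp.single e 1) (A a b) ≠ 0 → e.2 = β a) ∧
        ∀ c : Fin n, (Finset.univ.filter fun a => β a = c).card = n.choose c := by
  intro n hn
  exact exists_rowPartitioned hn (by have := @Nat.one_le_two_pow n; omega)

end Summit.ValiantsHypothesis.ValiantsHypothesis.Theorems.DetQPDetqpThesis.FatRowGrenet

end
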